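import Summits.RiemannHypothesis.RiemannHypothesis.Theorems.WeilFormatCArchNodeSumExpansion
import Summits.RiemannHypothesis.RiemannHypothesis.Theorems.WeilFormatCPolyWindowConstantsBox
import HarnessLib

/-!
# Format C, design C∞ (E2, data side): a kernel box for the NODE MOMENTS `D_s(a) = Σ_k e^{−2a l_k} l_k^s`

Route context: Fourier–Galerkin / Schur-complement certificates of Weil positivity on a window ("format C", C∞ door;
cell memo `run/shared/lean/pub/rh-explicit/rh-explicit-weil-2/gen15/E2-PLAN-v2.md` §5; supporting stmt-RiemannHypothesis-0098;
seat rh-explicit-weil-2).  The printed monomial lists of the C∞ door (`WeilFormatCCinfArchMonomials`,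
`WeilFormatCCinfRowMonomials`, `WeilFormatCCinfImageMonomials`) carry, in their coefficients and remainders, the node
moments `D_s(a) = Σ_{k ≥ 0} e^{−2a l_k} l_k^s` (`l_k = 2k + ½`, `s : ℕ`) of the archimedean density.  The rung generator
(E2) must BOX these numbers for the kernel.  Here (interval plumbing only, no new analysis):

* `CinfCoeff.momNear` / `mem_momNear` — the partial sum `Σ_{k<K} e^{−2a l_k} l_k^s` from `WinConst.nodeExp ∋ e^{−2a l_k}`
  and the exact rationals `l_k^s = ((4k+1)/2)^s`;
* `CinfCoeff.nodeMomentBox` / `mem_nodeMomentBox` — `D_s(a) ∈ Σ_{k<K}(…) + [0, 2 e^{−2a l_K} l_K^s]` whenever the side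
  condition `e^{−4a}(1 + 2/l_K)^s ≤ ½` of `tsum_exp_mul_node_pow_sub_sum_le` (`WeilFormatCArchNodeSumExpansion`) is
  certified on boxes (`momTailOK`).

Precision: the near terms multiply a one-ulp box of `e^{−2a l_k}` by the exact rational `l_k^s`, so the absolute width is
`≈ Σ_{k<K} l_k^s / S`; choose `S ≳ 2^{64}·l_K^s` (at `a = 1`, `K = 45`, `S = 2^256`: `D_s` to relative `1e-12` for all
`s ≤ 57`, checked by `#guard` against a float evaluation; `S = 2^128` is too coarse beyond `s ≈ 20`).
Fixed-point intervals `MI` at scale `S` (`Literature.Analysis.ValidatedNumerics.NumericsMP`); standard axioms; no RH claim.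
-/

set_option autoImplicit false
-- `Summit.RiemannHypothesis.RiemannHypothesis.…` is the layout-mandated namespace (summit = problem name).
set_option linter.dupNamespace false

open Finset
open scoped Real

namespace Summit.RiemannHypothesis.RiemannHypothesis.Theorems.WeilFormatC

open Literature.Analysis.SpecialFunctions
open Literature.Analysis.ValidatedNumerics Literature.Analysis.ValidatedNumerics.NumericsMP

namespace CinfCoeff

open WinConst (ratBox mem_ratBox mulRatBox mem_mulRatBox nodeExp mem_nodeExp)

variable {S Kser kred : ℕ} {a : ℚ}

/-- `l_k^s` as a rational number: `((4k+1)/2)^s`. -/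
def nodePowQ (k s : ℕ) : ℚ := ((4 * (k : ℚ) + 1) / 2) ^ s

/-- `l_k^s = nodePowQ k s`. -/
theorem digammaNode_pow_eq (k s : ℕ) : digammaNode k ^ s = ((nodePowQ k s : ℚ) : ℝ) := by
  rw [nodePowQ, digammaNode]; push_cast; ring

/-- Near part `Σ_{k<K} e^{−2a l_k} l_k^s`. -/
def momNear (S Kser kred : ℕ) (a : ℚ) (s : ℕ) : ℕ → Option MI
  | 0 => some (MI.ofInt S 0)
  | K + 1 =>
    match momNear S Kser kred a s K, nodeExp S Kser kred a K with
    | some acc, some E => some (acc.add (mulRatBox E (nodePowQ K s)))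
    | _, _ => none

/-- `momNear ∋ Σ_{k<K} e^{−2a l_k} l_k^s`. -/
theorem mem_momNear (hS : 0 < S) (s : ℕ) :
    ∀ (K : ℕ) {N : MI}, momNear S Kser kred a s K = some N →
      MI.mem S (∑ k ∈ Finset.range K, Real.exp (-(2 * (a : ℝ) * digammaNode k)) * digammaNode k ^ s) N
  | 0, N, h => by
    simp only [momNear, Option.some.injEq] at h
    subst h; simpa using MI.mem_ofInt S 0
  | K + 1, N, h => by
    simp only [momNear] at h
    split at h
    · rename_i acc E hacc hE
      simp only [Option.some.injEq] at h
      subst h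
      rw [Finset.sum_range_succ]
      refine MI.mem_add (mem_momNear hS s K hacc) ?_
      have h := mem_mulRatBox (mem_nodeExp hS hE) (nodePowQ K s)
      rw [digammaNode_pow_eq]
      exact h
    · simp at h

/-- Certified side condition of the geometric tail: an upper box of `e^{−4a}·(1 + 2/l_K)^s` is `≤ ½`
(`1 + 2/l_K = 1 + 4/(4K+1)`). -/
def momTailOK (S Kser kred : ℕ) (a : ℚ) (s K : ℕ) : Bool :=
  match MI.exp S Kser kred (ratBox S (-(4 * a))) with
  | some E4 => decide (2 * (mulRatBox E4 ((1 + 4 / (4 * (K : ℚ) + 1)) ^ s)).hi ≤ (S : ℤ))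
  | none => false

/-- `momTailOK = true` certifies `e^{−4a}(1 + 2/l_K)^s ≤ ½`. -/
theorem ratio_le_half_of_momTailOK (hS : 0 < S) {s K : ℕ} (h : momTailOK S Kser kred a s K = true) :
    Real.exp (-(4 * (a : ℝ))) * (1 + 2 / digammaNode K) ^ s ≤ 1 / 2 := by
  unfold momTailOK at h
  split at h
  · rename_i E4 hE4
    have hdec := of_decide_eq_true h
    have hE4m : MI.mem S (Real.exp (-(4 * (a : ℝ)))) E4 := by
      have := MI.mem_exp hS hE4 (mem_ratBox S (-(4 * a)))
      convert this using 2; push_cast; ring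
    have hm := mem_mulRatBox hE4m ((1 + 4 / (4 * (K : ℚ) + 1)) ^ s)
    have hq : (((1 + 4 / (4 * (K : ℚ) + 1)) ^ s : ℚ) : ℝ) = (1 + 2 / digammaNode K) ^ s := by
      rw [digammaNode]; push_cast
      congr 1
      have : (4 * (K : ℝ) + 1) ≠ 0 := by positivity
      have : (2 * (K : ℝ) + 1 / 2) ≠ 0 := by positivity
      field_simp
      ring
    rw [hq] at hm
    have hSr : (0 : ℝ) < S := by exact_mod_cast hS
    have h2 : 2 * ((mulRatBox E4 ((1 + 4 / (4 * (K : ℚ) + 1)) ^ s)).hi : ℝ) ≤ (S : ℝ) := by exact_mod_cast hdec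
    have := hm.2
    nlinarith
  · simp at h

/-- **The node-moment box**: `Σ_{k<K} e^{−2a l_k} l_k^s + [0, 2 e^{−2a l_K} l_K^s]` (only when `momTailOK`). -/
def nodeMomentBox (S Kser kred : ℕ) (a : ℚ) (s K : ℕ) : Option MI :=
  if momTailOK S Kser kred a s K then
    match momNear S Kser kred a s K, nodeExp S Kser kred a K with
    | some N, some E => some (N.add ⟨0, (mulRatBox E (2 * nodePowQ K s)).hi⟩)
    | _, _ => none
  else none

/-- **`nodeMomentBox ∋ D_s(a) = Σ_k e^{−2a l_k} l_k^s`** (`a > 0`). -/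
theorem mem_nodeMomentBox (hS : 0 < S) (ha : 0 < a) {s K : ℕ} {B : MI}
    (h : nodeMomentBox S Kser kred a s K = some B) :
    MI.mem S (∑' k : ℕ, Real.exp (-(2 * (a : ℝ) * digammaNode k)) * digammaNode k ^ s) B := by
  have ha' : (0 : ℝ) < a := by exact_mod_cast ha
  have hSr : (0 : ℝ) < S := by exact_mod_cast hS
  unfold nodeMomentBox at h
  split at h
  · rename_i hok
    split at h
    · rename_i N E hN hE
      simp only [Option.some.injEq] at h
      subst h
      have hq := ratio_le_half_of_momTailOK (Kser := Kser) (kred := kred) hS hok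
      obtain ⟨h0, h1⟩ := tsum_exp_mul_node_pow_sub_sum_le ha' s K hq
      set T := ∑' k : ℕ, Real.exp (-(2 * (a : ℝ) * digammaNode k)) * digammaNode k ^ s with hT
      set P := ∑ k ∈ Finset.range K, Real.exp (-(2 * (a : ℝ) * digammaNode k)) * digammaNode k ^ s with hP
      have hsplit : T = P + (T - P) := by ring
      rw [hsplit]
      refine MI.mem_add (mem_momNear hS s K hN) ⟨?_, ?_⟩
      · push_cast; exact mul_nonneg h0 hSr.le
      · have hm := mem_mulRatBox (mem_nodeExp hS hE) (2 * nodePowQ K s)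
        have e2 : Real.exp (-(2 * (a : ℝ) * digammaNode K)) * ((2 * nodePowQ K s : ℚ) : ℝ)
            = 2 * (Real.exp (-(2 * (a : ℝ) * digammaNode K)) * digammaNode K ^ s) := by
          rw [digammaNode_pow_eq]; push_cast; ring
        rw [e2] at hm
        exact le_trans (mul_le_mul_of_nonneg_right h1 hSr.le) hm.2
    · simp at h
  · simp at h

end CinfCoeff

end Summit.RiemannHypothesis.RiemannHypothesis.Theorems.WeilFormatC
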